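import Literature.InformationTheory.QuantumCodes.AbelianTwoBlockParameters
import Literature.InformationTheory.QuantumCodes.TwoBlockCodeEquivalences
import Literature.InformationTheory.QuantumCodes.HypergraphProductSectorExact
import Literature.InformationTheory.QuantumCodes.HypergraphProductDimension
import Literature.InformationTheory.Coding.SubfieldImage
import HarnessLib

/-!
# Two-block codes over a direct product with separated supports ARE hypergraph products:
# `LP[a ⊗ 1, 1 ⊗ b] = HP(circ a, circ b)`, hence `[[2 n_a n_b, 2 k_a k_b, min(d_a, d_b)]]` (Lin–Pryadko 2024 §IV.C)

Topic `InformationTheory/QuantumCodes`; namespace `Literature.InformationTheory.QuantumCodes.AbelianTwoBlock`.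
LADDER-QEC (cell `qec`), LIT-3 constructions (register §3 T4 / D6).

Source followed. H.-K. Lin, L. P. Pryadko, *Quantum two-block group algebra codes*, PRA **109** (2024) 022407
= arXiv:2306.16400 [LinPryadko2024], §IV.C after Statement 8 (held text chunk p0010 L66–78):

> «In particular, with disjoint subgroups, `G_a ∩ G_b = {1}`, the group in Statement 8 is just a direct product
> of the two subgroups, `G' = G_a × G_b`. In this case we can independently choose the order of elements in each
> subgroup, and both matrices may simultaneously have the form of Kronecker products, `A = A₁ ⊗ I_{n_b}`,
> `B = I_{n_a} ⊗ B₁`, with `n_b ≡ |G_b| = m_a` and `n_a ≡ |G_a| = m_b`. This is exactly the block structure of an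
> HP code [Tillich-Zemor-2009], constructed from square matrices `A₁` and `B₁`. If we denote the parameters of
> classical linear codes with parity check matrices `A₁` and `B₁`, respectively, as `[n_a,k_a,d_a]_q` and
> `[n_b,k_b,d_b]_q` (these parameters remain the same when the transposed matrices are used), the parameters
> of the quantum HP code are known explicitly, `[[2n_an_b, 2k_ak_b, min(d_a,d_b)]]_q`.»

(and §IV.F, chunk p0012 L24–31: «when `c = 1` … `d_Z = min(d_A^⊥, d_B^⊥)`. Of course, the same result for
the distance can be also obtained from the map to a hypergraph-product code constructed from the single-block
classical group algebra codes with groups `G_a` and `G_b`.»)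

## What is proved (binary case `F = 𝔽₂`, the tree's CSS setting; 0 named facts)

For finite abelian groups `G₁, G₂` and coefficient vectors `a : G₁ → 𝔽₂`, `b : G₂ → 𝔽₂`, put
`a ⊗ 1 := prodInl a`, `1 ⊗ b := prodInr b : G₁ × G₂ → 𝔽₂` (the vectors `a`, `b` placed on the subgroups
`G₁ × 0`, `0 × G₂` of `G = G₁ × G₂`). Then for the tree's abelian two-block code `css` (`H_X = [A|B]`,
`H_Z = [Bᵀ|Aᵀ]`, `AbelianTwoBlockCodes.lean`) and Tillich–Zémor's hypergraph product (`HypergraphProduct.xMatrix`,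
`zMatrix`, `HypergraphProduct.lean`):

* `circulant_prodInl`, `circulant_prodInr` — `circ(a ⊗ 1) = circ a ⊗ 1`, `circ(1 ⊗ b) = 1 ⊗ circ b`;
* `css_prod_HX`, `css_prod_HZ` — **`LP[a ⊗ 1, 1 ⊗ b]` IS the hypergraph product `Q_{ℋ₁·ℋ₂}` with `H₁ = circ a`,
  `H₂ = circ b`**: the check matrices are EQUAL (same index types, no re-indexing);
* `pcCode_circulant_transpose`, `minDist_pcCode_circulant_transpose`, `finrank_pcCode_circulant_transpose` — «these
  parameters remain the same when the transposed matrices are used» (`(circ a)ᵀ = circ a` re-indexed by `g ↦ −g`);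
* `css_prod_k` — `k = 2 k_a k_b` (`k_a = dim ker circ a`), from Tillich–Zémor Thm 7 (`rank_xMatrix_add`,
  `rank_zMatrix_add`);
* `css_prod_cssMinDist` — the CSS minimum distance in closed form from the tree's exact hypergraph-product formula
  (`HypergraphProduct.cssMinDist_xMatrix_eq`, Zeng–Pryadko Thm 17): `min(d_a, d_b)` when `k_a, k_b > 0`, `⊤` when
  `k_a = 0` or `k_b = 0`;
* `css_prod_isCode` — **the printed parameters `[[2 n_a n_b, 2 k_a k_b, min(d_a, d_b)]]`** as the census predicate
  `CSSCode.IsCode`, for `k_a, k_b > 0`; and `css_prod_isCode_of_addEquiv` — the same for a code over any `G`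
  transported along an isomorphism `φ : G₁ × G₂ ≃+ G` (LP24 Thm 6(i), `TwoBlockCodeEquivalences.lean`), i.e. for
  `LP[a,b]` over `G` whenever `supp a`, `supp b` lie in complementary subgroups `G = G_a ⊕ G_b`.

The general Statement 8 (non-abelian `G`, or `N = G_a ∩ G_b ≠ 0`) is not typed here (`TODO(general form)`; the
distance lower bound for `N ≠ 0` is `QuasiAbelianLPDistance.lean`).
-/

namespace Literature.InformationTheory.QuantumCodes

open Matrix Module
open scoped Kronecker
open Literature.InformationTheory.Coding (minDist reindex mem_reindex_iff minDist_reindex)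

namespace AbelianTwoBlock

variable {G₁ G₂ : Type*} [AddCommGroup G₁] [AddCommGroup G₂]

/-! ### The separated-support coefficient vectors -/

/-- `a ⊗ 1 ∈ 𝔽₂[G₁ × G₂]`: the vector `a ∈ 𝔽₂[G₁]` placed on the subgroup `G₁ × 0`. (definition)
[cite: LinPryadko2024, §IV.C (arXiv:2306.16400 chunk p0010 L66–72: «A = A₁ ⊗ I_{n_b}»)] -/
def prodInl [DecidableEq G₂] (a : G₁ → ZMod 2) : G₁ × G₂ → ZMod 2 := fun g => if g.2 = 0 then a g.1 else 0

/-- `1 ⊗ b ∈ 𝔽₂[G₁ × G₂]`: the vector `b ∈ 𝔽₂[G₂]` placed on the subgroup `0 × G₂`. (definition)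
[cite: LinPryadko2024, §IV.C (arXiv:2306.16400 chunk p0010 L66–72: «B = I_{n_a} ⊗ B₁»)] -/
def prodInr [DecidableEq G₁] (b : G₂ → ZMod 2) : G₁ × G₂ → ZMod 2 := fun g => if g.1 = 0 then b g.2 else 0

omit [AddCommGroup G₁] in
/-- `prodInl a (g₁, g₂) = [g₂ = 0] · a g₁`. [cite: LinPryadko2024, §IV.C (arXiv:2306.16400 chunk p0010 L66–72)] -/
@[simp] theorem prodInl_apply [DecidableEq G₂] (a : G₁ → ZMod 2) (g : G₁ × G₂) :
    prodInl a g = if g.2 = 0 then a g.1 else 0 := rfl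

omit [AddCommGroup G₂] in
/-- `prodInr b (g₁, g₂) = [g₁ = 0] · b g₂`. [cite: LinPryadko2024, §IV.C (arXiv:2306.16400 chunk p0010 L66–72)] -/
@[simp] theorem prodInr_apply [DecidableEq G₁] (b : G₂ → ZMod 2) (g : G₁ × G₂) :
    prodInr b g = if g.1 = 0 then b g.2 else 0 := rfl

/-- **`circ(a ⊗ 1) = circ a ⊗ 1`.** [cite: LinPryadko2024, §IV.C (arXiv:2306.16400 chunk p0010 L69–72: «A = A₁ ⊗ I_{n_b}»)] -/
theorem circulant_prodInl [DecidableEq G₂] (a : G₁ → ZMod 2) :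
    circulant (prodInl a) = circulant a ⊗ₖ (1 : Matrix G₂ G₂ (ZMod 2)) := by
  ext ⟨g₁, g₂⟩ ⟨h₁, h₂⟩
  simp only [circulant_apply, prodInl_apply, Prod.snd_sub, Prod.fst_sub, kroneckerMap_apply, one_apply,
    sub_eq_zero]
  split_ifs <;> simp

/-- **`circ(1 ⊗ b) = 1 ⊗ circ b`.** [cite: LinPryadko2024, §IV.C (arXiv:2306.16400 chunk p0010 L69–72: «B = I_{n_a} ⊗ B₁»)] -/
theorem circulant_prodInr [DecidableEq G₁] (b : G₂ → ZMod 2) :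
    circulant (prodInr b) = (1 : Matrix G₁ G₁ (ZMod 2)) ⊗ₖ circulant b := by
  ext ⟨g₁, g₂⟩ ⟨h₁, h₂⟩
  simp only [circulant_apply, prodInr_apply, Prod.snd_sub, Prod.fst_sub, kroneckerMap_apply, one_apply,
    sub_eq_zero]
  split_ifs <;> simp

variable [Fintype G₁] [Fintype G₂] [DecidableEq G₁] [DecidableEq G₂]

/-- **`H_X(LP[a ⊗ 1, 1 ⊗ b]) = H_X(Q_{ℋ₁·ℋ₂})`, `H₁ = circ a`, `H₂ = circ b`** — an EQUALITY of matrices on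
`(G₁ × G₂) × ((G₁ × G₂) ⊕ (G₁ × G₂))`. [cite: LinPryadko2024, §IV.C (arXiv:2306.16400 chunk p0010 L72–74: «This is exactly the block structure of an HP code [Tillich-Zemor-2009], constructed from square matrices A₁ and B₁»)] -/
theorem css_prod_HX (a : G₁ → ZMod 2) (b : G₂ → ZMod 2) :
    (css (prodInl a) (prodInr b)).HX = HypergraphProduct.xMatrix (circulant a) (circulant b) := by
  rw [css_HX, HX_def, circulant_prodInl, circulant_prodInr]; rfl

/-- **`H_Z(LP[a ⊗ 1, 1 ⊗ b]) = H_Z(Q_{ℋ₁·ℋ₂})`** (`[Bᵀ|Aᵀ] = [1 ⊗ H₂ᵀ | H₁ᵀ ⊗ 1]`).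
[cite: LinPryadko2024, §IV.C (arXiv:2306.16400 chunk p0010 L72–74)] -/
theorem css_prod_HZ (a : G₁ → ZMod 2) (b : G₂ → ZMod 2) :
    (css (prodInl a) (prodInr b)).HZ = HypergraphProduct.zMatrix (circulant a) (circulant b) := by
  rw [css_HZ, HZ_def, circulant_prodInl, circulant_prodInr, ← kroneckerMap_transpose, ← kroneckerMap_transpose,
    transpose_one, transpose_one]; rfl

/-! ### «These parameters remain the same when the transposed matrices are used» -/

section Transpose

variable {G : Type*} [AddCommGroup G] [Fintype G]

omit [Fintype G₁] [Fintype G₂] [DecidableEq G₁] [DecidableEq G₂] [Fintype G] in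
/-- `(circ a)ᵀ = circ a` re-indexed by negation on rows and columns. [cite: LinPryadko2024, §IV.C (arXiv:2306.16400 chunk p0010 L75–76: «these parameters remain the same when the transposed matrices are used»)] -/
theorem circulant_transpose_eq_submatrix (a : G → ZMod 2) :
    (circulant a)ᵀ = (circulant a).submatrix (Equiv.neg G) (Equiv.neg G) := by
  ext g h
  simp only [transpose_apply, circulant_apply, submatrix_apply, Equiv.neg_apply, neg_sub_neg]

omit [Fintype G₁] [Fintype G₂] [DecidableEq G₁] [DecidableEq G₂] in
/-- The code of `(circ a)ᵀ` is the code of `circ a` re-indexed by `g ↦ −g`.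
[cite: LinPryadko2024, §IV.C (arXiv:2306.16400 chunk p0010 L75–76)] -/
theorem pcCode_circulant_transpose (a : G → ZMod 2) :
    pcCode (circulant a)ᵀ = reindex (Equiv.neg G) (pcCode (circulant a)) := by
  ext y
  rw [mem_reindex_iff, mem_pcCode_iff, mem_pcCode_iff, circulant_transpose_eq_submatrix,
    Matrix.submatrix_mulVec_equiv]
  have hy : (y ∘ (Equiv.neg G).symm) = LinearEquiv.funCongrLeft (ZMod 2) (ZMod 2) (Equiv.neg G) y := by
    funext g; simp [LinearEquiv.funCongrLeft_apply, LinearMap.funLeft_apply]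
  rw [hy]
  constructor
  · intro h
    funext g
    have := congrFun h (-g)
    simpa using this
  · intro h
    rw [h]
    rfl

omit [Fintype G₁] [Fintype G₂] [DecidableEq G₁] [DecidableEq G₂] in
/-- `d(ker (circ a)ᵀ) = d(ker circ a)`. [cite: LinPryadko2024, §IV.C (arXiv:2306.16400 chunk p0010 L75–76)] -/
theorem minDist_pcCode_circulant_transpose (a : G → ZMod 2) :
    minDist (pcCode (circulant a)ᵀ) = minDist (pcCode (circulant a)) := by
  rw [pcCode_circulant_transpose, minDist_reindex]

omit [Fintype G₁] [Fintype G₂] [DecidableEq G₁] [DecidableEq G₂] in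
/-- `dim ker (circ a)ᵀ = dim ker circ a`. [cite: LinPryadko2024, §IV.C (arXiv:2306.16400 chunk p0010 L75–76)] -/
theorem finrank_pcCode_circulant_transpose (a : G → ZMod 2) :
    finrank (ZMod 2) (pcCode (circulant a)ᵀ) = finrank (ZMod 2) (pcCode (circulant a)) := by
  rw [pcCode_circulant_transpose]
  unfold Literature.InformationTheory.Coding.reindex
  exact LinearEquiv.finrank_map_eq _ _

omit [Fintype G₁] [Fintype G₂] [DecidableEq G₁] [DecidableEq G₂] in
/-- `ker (circ a)ᵀ = 0 ↔ ker circ a = 0`. [cite: LinPryadko2024, §IV.C (arXiv:2306.16400 chunk p0010 L75–76)] -/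
theorem pcCode_circulant_transpose_eq_bot_iff (a : G → ZMod 2) :
    pcCode (circulant a)ᵀ = ⊥ ↔ pcCode (circulant a) = ⊥ := by
  rw [← Submodule.finrank_eq_zero, ← Submodule.finrank_eq_zero, finrank_pcCode_circulant_transpose]

end Transpose

/-! ### The parameters -/

/-- **`k = 2 k_a k_b`** for `LP[a ⊗ 1, 1 ⊗ b]` (`k_a = dim ker circ a`, `k_b = dim ker circ b`), from Tillich–Zémor's
Theorem 7 for square seed matrices. [cite: LinPryadko2024, §IV.C (arXiv:2306.16400 chunk p0010 L77–78: «[[2n_an_b, 2k_ak_b, min(d_a,d_b)]]»)]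
[cite: TillichZemor2014, Thm 7 (arXiv:0903.0566v1 chunk p0007 L126–135)] -/
theorem css_prod_k (a : G₁ → ZMod 2) (b : G₂ → ZMod 2) :
    (css (prodInl a) (prodInr b)).k =
      2 * finrank (ZMod 2) (pcCode (circulant a)) * finrank (ZMod 2) (pcCode (circulant b)) := by
  have hk := (css (prodInl a) (prodInr b)).k_eq
  have hle := (css (prodInl a) (prodInr b)).rank_HX_add_rank_HZ_le
  rw [css_prod_HX, css_prod_HZ] at hk hle
  have hX := HypergraphProduct.rank_xMatrix_add (circulant a) (circulant b)
  have hZ := HypergraphProduct.rank_zMatrix_add (circulant a) (circulant b)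
  rw [finrank_pcCode_circulant_transpose, finrank_pcCode_circulant_transpose] at hX
  have hcard : Fintype.card ((G₁ × G₂) ⊕ (G₁ × G₂)) = 2 * (Fintype.card G₁ * Fintype.card G₂) := by
    simp only [Fintype.card_sum, Fintype.card_prod]; ring
  rw [hcard] at hk hle
  rw [hk, Nat.mul_assoc]
  omega

omit [AddCommGroup G₁] [AddCommGroup G₂] [DecidableEq G₁] [DecidableEq G₂] in
/-- The number of qubits: `n = 2 n_a n_b`. [cite: LinPryadko2024, §IV.C (arXiv:2306.16400 chunk p0010 L77–78)] -/
theorem card_qubits_prod : Fintype.card ((G₁ × G₂) ⊕ (G₁ × G₂)) = 2 * Fintype.card G₁ * Fintype.card G₂ := by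
  simp only [Fintype.card_sum, Fintype.card_prod]; ring

/-- **The CSS minimum distance of `LP[a ⊗ 1, 1 ⊗ b]` in closed form** (the tree's exact hypergraph-product formula
with the transposes removed): `min(d_a·[k_b ≠ 0], [k_a ≠ 0]·d_b)` in both sectors, i.e. `min(d_a, d_b)` when
`k_a, k_b > 0` and `⊤` (no logical operator) otherwise.
[cite: LinPryadko2024, §IV.C and §IV.F (arXiv:2306.16400 chunk p0010 L75–78; p0012 L24–31: «c = 1 … d_Z = min(d_A^⊥, d_B^⊥) … also obtained from the map to a hypergraph-product code»)]
[cite: ZengPryadko2020, Thm 17 (arXiv:2007.12152 chunk p0018 L1-12)] -/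
theorem css_prod_cssMinDist (a : G₁ → ZMod 2) (b : G₂ → ZMod 2) :
    cssMinDist (css (prodInl a) (prodInr b)).HX (css (prodInl a) (prodInr b)).HZ =
      min (⨅ (_ : pcCode (circulant b) ≠ ⊥), minDist (pcCode (circulant a)))
          (⨅ (_ : pcCode (circulant a) ≠ ⊥), minDist (pcCode (circulant b))) := by
  rw [css_prod_HX, css_prod_HZ, HypergraphProduct.cssMinDist_xMatrix_eq, minDist_pcCode_circulant_transpose,
    minDist_pcCode_circulant_transpose]
  simp only [ne_eq, pcCode_circulant_transpose_eq_bot_iff, min_self]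

/-- **Lin–Pryadko §IV.C: `LP[a ⊗ 1, 1 ⊗ b]` is a `[[2 n_a n_b, 2 k_a k_b, min(d_a, d_b)]]` code** when both classical
codes `ker circ a = [n_a, k_a, d_a]`, `ker circ b = [n_b, k_b, d_b]` are nonzero (the census predicate `IsCode`, exact
distance). [cite: LinPryadko2024, §IV.C (arXiv:2306.16400 chunk p0010 L74–78: «the parameters of the quantum HP code are known explicitly, [[2n_an_b, 2k_ak_b, min(d_a,d_b)]]»)] -/
theorem css_prod_isCode (a : G₁ → ZMod 2) (b : G₂ → ZMod 2) {ka kb da db : ℕ}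
    (hka : finrank (ZMod 2) (pcCode (circulant a)) = ka) (hkb : finrank (ZMod 2) (pcCode (circulant b)) = kb)
    (hka0 : 0 < ka) (hkb0 : 0 < kb)
    (hda : minDist (pcCode (circulant a)) = da) (hdb : minDist (pcCode (circulant b)) = db) :
    (css (prodInl a) (prodInr b)).IsCode (2 * Fintype.card G₁ * Fintype.card G₂) (2 * ka * kb) (min da db) := by
  refine ⟨card_qubits_prod, by rw [css_prod_k, hka, hkb], ?_⟩
  have ha : pcCode (circulant a) ≠ ⊥ := fun h0 => by
    rw [h0, finrank_bot] at hka; omega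
  have hb : pcCode (circulant b) ≠ ⊥ := fun h0 => by
    rw [h0, finrank_bot] at hkb; omega
  have hmin : ((min da db : ℕ) : ℕ∞) = min (da : ℕ∞) (db : ℕ∞) := by
    rcases le_total da db with h | h
    · rw [min_eq_left h, min_eq_left (Nat.cast_le.2 h)]
    · rw [min_eq_right h, min_eq_right (Nat.cast_le.2 h)]
  rw [css_prod_cssMinDist, iInf_pos hb, iInf_pos ha, hda, hdb, hmin]

/-- **The same for a two-block code over any `G ≅ G₁ × G₂`** (supports in complementary subgroups): transport along
`φ : G₁ × G₂ ≃+ G` by Lin–Pryadko Thm 6(i) (`css_mapEquiv_isCode_iff`).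
[cite: LinPryadko2024, §IV.C (arXiv:2306.16400 chunk p0010 L66–78) and §IV.B Thm 6(i) (chunk p0009 L72–80)] -/
theorem css_prod_isCode_of_addEquiv {G : Type*} [AddCommGroup G] [Fintype G] [DecidableEq G] (φ : G₁ × G₂ ≃+ G)
    (a : G₁ → ZMod 2) (b : G₂ → ZMod 2) {ka kb da db : ℕ}
    (hka : finrank (ZMod 2) (pcCode (circulant a)) = ka) (hkb : finrank (ZMod 2) (pcCode (circulant b)) = kb)
    (hka0 : 0 < ka) (hkb0 : 0 < kb)
    (hda : minDist (pcCode (circulant a)) = da) (hdb : minDist (pcCode (circulant b)) = db) :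
    (css (prodInl a ∘ φ.symm) (prodInr b ∘ φ.symm)).IsCode (2 * Fintype.card G₁ * Fintype.card G₂) (2 * ka * kb)
      (min da db) :=
  (css_mapEquiv_isCode_iff (prodInl a) (prodInr b) φ _ _ _).2 (css_prod_isCode a b hka hkb hka0 hkb0 hda hdb)

end AbelianTwoBlock

end Literature.InformationTheory.QuantumCodes
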